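import Summits.BirchSwinnertonDyer.BirchSwinnertonDyer.Theorems.SchneiderFreeAdditiveX3PoitouTatePresentationPairingSignFree
import Literature.NumberTheory.GaloisRepresentations.IdeleProjectionAssembly
import Literature.NumberTheory.GaloisRepresentations.IdeleClassBarInvariantCompare
import HarnessLib

/-!
# Poitou–Tate toolkit: the presentation road with THE idèle projections — `hE` from Tate duality for `(Γ_K, C̄)`
# (door-c4's record) and the pairing dictionary (R4) ALONE

Cell `bsd-schneider-ideate`, seat `bsd-schneider-door-c5` (prover, generation 17).  PARTITION: board row
B6 ∩ X3 ∩ sst-twist, `r = 1`, of `Rank1Residual.partition` — CONTROL corner (crux `AnticycControlAdditiveK`,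
stmt-BirchSwinnertonDyer-19295; facts binder `ControlFacts` (i) = `poitouTate_selmerStructure_duality K` = hE).
Helper file (`--supports`); theorems only; no `sorry`.

WHAT IS NEW.  Door-c6 g17's `poitouTate_selmerStructure_duality_of_assembly inv hT π hAsm hR4` /
`…_of_globalTerms_of_imp inv hT π hAsm hE` reduce hE to FIVE inputs.  Three of them are now THEOREMS of the tree:
* `π := IdeleReadout.ideleProjection K` — door-c5 g17's idèle projections `J̄ → K̄_vˣ` at every place
  (`Literature/…/IdeleProjection.lean`: the limit of the layer readouts "`w_v`-component, then `E_{w_v} → K̄_v`");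
* `hAsm := IdeleReadout.ideleAssembly` — door-c5 g17's idèle ASSEMBLY (Milne I Lemma 4.13;
  `Literature/…/IdeleProjectionAssembly.lean`, verbatim the hypothesis);
* `hT := IdeleClassBar.tateDualityHypotheses_classBarD_classBarInv K` — door-c4 g16/g17's Tate duality record for the
  idèle class formation with `inv := classBarInv K` (`Literature/…/IdeleClassBarInvariantCompare.lean`).
Hence **`poitouTate_selmerStructure_duality_of_pairingDictionary`**: hE ⟸ (R4) for `(classBarInv K, ideleProjection K)`,
and **`poitouTate_selmerStructure_duality_of_reciprocitySum`**: hE ⟸ the SIGN-FREE E-side statement in global terms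
(`hE` of `…_of_globalTerms_of_imp`) for `(classBarInv K, ideleProjection K)` — ONE remaining input, the E-side
reciprocity sum (door-c4 (b)+(c), door-c5 F7-dict (ii) = `IdeleCohomology.localInvAt_embPlace_eq_readout`, door-c6 (N2)).
Also the `inv`-generic forms (`…_of_pairingDictionary'`, `…_of_reciprocitySum'`) for door-c4's `classBarInvD`.

HONEST FRAMING: reductions; no case of Poitou–Tate or BSD is proved; the crux stubs baseCountTors / ptSurj / coinv
stay F2 behind hE.  closes rung: none.

## References
* J. S. Milne, *Arithmetic Duality Theorems* (2nd ed. 2006), I Thm. 4.10 (proof, p. 58), Lemma 4.13, Thm. 1.8. [MilneADT2006]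
* J. W. S. Cassels, A. Fröhlich (eds.), *Algebraic Number Theory* (1967), Ch. VII (Tate) §11.2 (bis). [CasselsFrohlichANT1967]
-/

noncomputable section

open Function NumberField IsDedekindDomain CategoryTheory CategoryTheory.Abelian
open scoped NumberField ContRepresentation

-- the summit's nested namespace `Summit.BirchSwinnertonDyer.BirchSwinnertonDyer.…` (layout D-0017) trips the linter
set_option linter.dupNamespace false

namespace Summit.BirchSwinnertonDyer.BirchSwinnertonDyer.Theorems.SchneiderFreeAdditiveX3.PoitouTateReduction

open Field
open Literature.NumberTheory.GaloisRepresentations Literature.NumberTheory.GaloisCohomology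
open Literature.NumberTheory.GaloisRepresentations.DiscreteGaloisModule (mu TateDual tateDual
  localTatePairingZMod unramifiedSubgroup)
open Literature.Algebra.Homology Literature.Algebra.Homology.DiscreteRep Literature.Algebra.Homology.ExtPresentation
open Literature.NumberTheory.GaloisRepresentations.IdeleClassBar (classBarD classBarInv tateDualityHypotheses_classBarD_classBarInv)
open Literature.NumberTheory.GaloisRepresentations.FreePresentation (presentationComplex presentationComplex_shortExact
  presModule₁ presModule₂ presIncl presProj pres_isSES moduleFinite_presModule₁ moduleFinite_presModule₂)
open Literature.NumberTheory.GaloisRepresentations.HomDual (IdeleProjection readout readoutInvariant localReadout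
  readout_eq_localReadout charZero_of_algebra equivariantMap restrictIntertwining isSES_restrict)
open Literature.NumberTheory.GaloisRepresentations.DGMBridge (LCarrier)
open Literature.AnabelianGeometry.AbsoluteAnabelian.Prop121vii (zmodToQmodZ brauerInvariantEquiv)

variable {K : Type} [Field K] [NumberField K]
variable (inv : Abelian.Ext (triv (Γ := absoluteGaloisGroup K) ℤ) (classBarD K) 2 →+ AddCircle (1 : ℚ))

/-- **hE from Tate duality for `(Γ_K, C̄, inv)` and the pairing dictionary (R4) for THE idèle projections** — door-c6's
`poitouTate_selmerStructure_duality_of_assembly` with `π := ideleProjection K` and `hAsm := ideleAssembly` discharged.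
[cite: MilneADT2006, Ch. I, Thm. 4.10(b) (proof, p. 58), Lemma 4.13][cite: CasselsFrohlichANT1967, Ch. VII §11.2 (bis)] -/
theorem poitouTate_selmerStructure_duality_of_pairingDictionary' (hT : TateDualityHypotheses (classBarD K) inv)
    (hR4 : ∀ (n : ℕ) [NeZero n],
      ∀ ⦃M : Type⦄ [AddCommGroup M] [TopologicalSpace M] [DiscreteTopology M] [Finite M] [Finite (TateDual K M n)]
      (ρ₀ : DiscreteGaloisModule K M) (hM : ∀ m : M, n • m = 0),
      ∀ (f : (presentationComplex ρ₀).X₁ ⟶ (ideleClassLimitShortComplex K).X₂)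
        (ŷ : Abelian.Ext (triv (Γ := absoluteGaloisGroup K) ℤ) (presentationComplex ρ₀).X₃ 1) (T₀ : Finset (Place K)),
        ∃ (y : galoisCohomology ((ρ₀.tateDual n).tateDual n) 1) (Ty : Finset (Place K)), T₀ ⊆ Ty ∧
          (∀ v : HeightOneSpectrum (𝓞 K), (Sum.inr v : Place K) ∉ Ty →
            galoisCohomology.localization ((ρ₀.tateDual n).tateDual n) (Sum.inr v) 1 y ∈
              unramifiedSubgroup (GaloisRep.toLocal v ((ρ₀.tateDual n).tateDual n)) 1) ∧
          ((∀ T' : Finset (Place K), Ty ⊆ T' →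
              ∑ v ∈ T', localTatePairingZMod (ρ₀.tateDual n) n v (LocalInvariants.canonical K n v)
                (readout ρ₀ n hM (IdeleReadout.ideleProjection K v) f)
                (galoisCohomology.localization ((ρ₀.tateDual n).tateDual n) v 1 y) = 0) →
            inv (ŷ.comp (boundary (presentationComplex_shortExact ρ₀) (classBarD K)
              (f ≫ (ideleClassLimitShortComplex K).g)) (rfl : 1 + 1 = 2)) = 0)) :
    poitouTate_selmerStructure_duality K :=
  poitouTate_selmerStructure_duality_of_assembly inv hT (IdeleReadout.ideleProjection K)
    (fun n _ => IdeleReadout.ideleAssembly (K := K) n) hR4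

/-- **hE from Tate duality for `(Γ_K, C̄, inv)` and the SIGN-FREE E-side reciprocity statement in global terms, for THE
idèle projections** — door-c6's `…_of_globalTerms_of_imp` with `π`, `hAsm` discharged.
[cite: MilneADT2006, Ch. I, Thm. 4.10(b) (proof, p. 58), Lemma 4.13][cite: CasselsFrohlichANT1967, Ch. VII §11.2 (bis)] -/
theorem poitouTate_selmerStructure_duality_of_reciprocitySum' (hT : TateDualityHypotheses (classBarD K) inv)
    (hE : ∀ (n : ℕ) [NeZero n],
      ∀ ⦃M : Type⦄ [AddCommGroup M] [TopologicalSpace M] [DiscreteTopology M] [Finite M] [Finite (TateDual K M n)]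
      (ρ₀ : DiscreteGaloisModule K M) (hM : ∀ m : M, n • m = 0)
      (ι : ρ₀.toContRepresentation →ⁱL ((ρ₀.tateDual n).tateDual n).toContRepresentation),
      (∀ (m : M) (f : TateDual K M n), ι m f = f m) →
      ∀ (f : (presentationComplex ρ₀).X₁ ⟶ (ideleClassLimitShortComplex K).X₂)
        (ŷ : Abelian.Ext (triv (Γ := absoluteGaloisGroup K) ℤ) (presentationComplex ρ₀).X₃ 1) (T₀ : Finset (Place K)),
        ∃ (x : galoisCohomology ρ₀ 1) (Tx : Finset (Place K)), T₀ ⊆ Tx ∧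
          (∀ v : HeightOneSpectrum (𝓞 K), (Sum.inr v : Place K) ∉ Tx →
            galoisCohomology.localization ρ₀ (Sum.inr v) 1 x ∈ unramifiedSubgroup (GaloisRep.toLocal v ρ₀) 1) ∧
          ∀ T' : Finset (Place K), Tx ⊆ T' →
            (∑ v ∈ T', Sum.elim
              (fun w : InfinitePlace K => zmodToQmodZ n
                (localTatePairingZMod (ρ₀.tateDual n) n (Sum.inl w) (LocalInvariants.canonical K n (Sum.inl w))
                  (readout ρ₀ n hM (IdeleReadout.ideleProjection K (Sum.inl w)) f)
                  (galoisCohomology.localization ((ρ₀.tateDual n).tateDual n) (Sum.inl w) 1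
                    (galoisCohomology.map ι 1 x))))
              (fun v : HeightOneSpectrum (𝓞 K) =>
                haveI := moduleFinite_presModule₁ ρ₀
                haveI : CharZero (v.adicCompletion K) := charZero_of_algebra (K := K) (v.adicCompletion K);
                - brauerInvariantEquiv (v.adicCompletion K)
                  (cohomologyMap (toTopRepHom ((presModule₁ ρ₀).restrictField (v.adicCompletion K))
                      (DiscreteGaloisModule.units (v.adicCompletion K))
                      (equivariantMap ((presModule₁ ρ₀).restrictField (v.adicCompletion K))
                        (DiscreteGaloisModule.units (v.adicCompletion K))
                        (readoutInvariant (IdeleReadout.ideleProjection K (Sum.inr v)) (presentationComplex ρ₀).X₁ f))) 2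
                    (galoisCohomology.res (presModule₁ ρ₀) (v.adicCompletion K) 2 ((pres_isSES ρ₀).δ₁ x))))
              v) = 0 →
            inv (ŷ.comp (boundary (presentationComplex_shortExact ρ₀) (classBarD K)
              (f ≫ (ideleClassLimitShortComplex K).g)) (rfl : 1 + 1 = 2)) = 0) :
    poitouTate_selmerStructure_duality K :=
  poitouTate_selmerStructure_duality_of_globalTerms_of_imp inv hT (IdeleReadout.ideleProjection K)
    (fun n _ => IdeleReadout.ideleAssembly (K := K) n) hE

/-- **hE ⟸ (R4) ALONE**: Tate duality for `(Γ_K, C̄, classBarInv K)` is door-c4's record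
`tateDualityHypotheses_classBarD_classBarInv`; the idèle projections and the assembly are door-c5's.
[cite: MilneADT2006, Ch. I, Thm. 4.10(b) (proof, p. 58), Lemma 4.13, Thm. 1.8][cite: CasselsFrohlichANT1967, Ch. VII §11.2 (bis)] -/
theorem poitouTate_selmerStructure_duality_of_pairingDictionary
    (hR4 : ∀ (n : ℕ) [NeZero n],
      ∀ ⦃M : Type⦄ [AddCommGroup M] [TopologicalSpace M] [DiscreteTopology M] [Finite M] [Finite (TateDual K M n)]
      (ρ₀ : DiscreteGaloisModule K M) (hM : ∀ m : M, n • m = 0),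
      ∀ (f : (presentationComplex ρ₀).X₁ ⟶ (ideleClassLimitShortComplex K).X₂)
        (ŷ : Abelian.Ext (triv (Γ := absoluteGaloisGroup K) ℤ) (presentationComplex ρ₀).X₃ 1) (T₀ : Finset (Place K)),
        ∃ (y : galoisCohomology ((ρ₀.tateDual n).tateDual n) 1) (Ty : Finset (Place K)), T₀ ⊆ Ty ∧
          (∀ v : HeightOneSpectrum (𝓞 K), (Sum.inr v : Place K) ∉ Ty →
            galoisCohomology.localization ((ρ₀.tateDual n).tateDual n) (Sum.inr v) 1 y ∈
              unramifiedSubgroup (GaloisRep.toLocal v ((ρ₀.tateDual n).tateDual n)) 1) ∧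
          ((∀ T' : Finset (Place K), Ty ⊆ T' →
              ∑ v ∈ T', localTatePairingZMod (ρ₀.tateDual n) n v (LocalInvariants.canonical K n v)
                (readout ρ₀ n hM (IdeleReadout.ideleProjection K v) f)
                (galoisCohomology.localization ((ρ₀.tateDual n).tateDual n) v 1 y) = 0) →
            classBarInv K (ŷ.comp (boundary (presentationComplex_shortExact ρ₀) (classBarD K)
              (f ≫ (ideleClassLimitShortComplex K).g)) (rfl : 1 + 1 = 2)) = 0)) :
    poitouTate_selmerStructure_duality K :=
  poitouTate_selmerStructure_duality_of_pairingDictionary' (classBarInv K) (tateDualityHypotheses_classBarD_classBarInv K) hR4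

/-- **hE ⟸ the SIGN-FREE E-side reciprocity sum ALONE** (for `inv := classBarInv K`, `π := ideleProjection K`).
[cite: MilneADT2006, Ch. I, Thm. 4.10(b) (proof, p. 58), Lemma 4.13, Thm. 1.8][cite: CasselsFrohlichANT1967, Ch. VII §11.2 (bis)] -/
theorem poitouTate_selmerStructure_duality_of_reciprocitySum
    (hE : ∀ (n : ℕ) [NeZero n],
      ∀ ⦃M : Type⦄ [AddCommGroup M] [TopologicalSpace M] [DiscreteTopology M] [Finite M] [Finite (TateDual K M n)]
      (ρ₀ : DiscreteGaloisModule K M) (hM : ∀ m : M, n • m = 0)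
      (ι : ρ₀.toContRepresentation →ⁱL ((ρ₀.tateDual n).tateDual n).toContRepresentation),
      (∀ (m : M) (f : TateDual K M n), ι m f = f m) →
      ∀ (f : (presentationComplex ρ₀).X₁ ⟶ (ideleClassLimitShortComplex K).X₂)
        (ŷ : Abelian.Ext (triv (Γ := absoluteGaloisGroup K) ℤ) (presentationComplex ρ₀).X₃ 1) (T₀ : Finset (Place K)),
        ∃ (x : galoisCohomology ρ₀ 1) (Tx : Finset (Place K)), T₀ ⊆ Tx ∧
          (∀ v : HeightOneSpectrum (𝓞 K), (Sum.inr v : Place K) ∉ Tx →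
            galoisCohomology.localization ρ₀ (Sum.inr v) 1 x ∈ unramifiedSubgroup (GaloisRep.toLocal v ρ₀) 1) ∧
          ∀ T' : Finset (Place K), Tx ⊆ T' →
            (∑ v ∈ T', Sum.elim
              (fun w : InfinitePlace K => zmodToQmodZ n
                (localTatePairingZMod (ρ₀.tateDual n) n (Sum.inl w) (LocalInvariants.canonical K n (Sum.inl w))
                  (readout ρ₀ n hM (IdeleReadout.ideleProjection K (Sum.inl w)) f)
                  (galoisCohomology.localization ((ρ₀.tateDual n).tateDual n) (Sum.inl w) 1
                    (galoisCohomology.map ι 1 x))))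
              (fun v : HeightOneSpectrum (𝓞 K) =>
                haveI := moduleFinite_presModule₁ ρ₀
                haveI : CharZero (v.adicCompletion K) := charZero_of_algebra (K := K) (v.adicCompletion K);
                - brauerInvariantEquiv (v.adicCompletion K)
                  (cohomologyMap (toTopRepHom ((presModule₁ ρ₀).restrictField (v.adicCompletion K))
                      (DiscreteGaloisModule.units (v.adicCompletion K))
                      (equivariantMap ((presModule₁ ρ₀).restrictField (v.adicCompletion K))
                        (DiscreteGaloisModule.units (v.adicCompletion K))
                        (readoutInvariant (IdeleReadout.ideleProjection K (Sum.inr v)) (presentationComplex ρ₀).X₁ f))) 2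
                    (galoisCohomology.res (presModule₁ ρ₀) (v.adicCompletion K) 2 ((pres_isSES ρ₀).δ₁ x))))
              v) = 0 →
            classBarInv K (ŷ.comp (boundary (presentationComplex_shortExact ρ₀) (classBarD K)
              (f ≫ (ideleClassLimitShortComplex K).g)) (rfl : 1 + 1 = 2)) = 0) :
    poitouTate_selmerStructure_duality K :=
  poitouTate_selmerStructure_duality_of_reciprocitySum' (classBarInv K) (tateDualityHypotheses_classBarD_classBarInv K) hE

end Summit.BirchSwinnertonDyer.BirchSwinnertonDyer.Theorems.SchneiderFreeAdditiveX3.PoitouTateReduction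

end
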